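import Summits.AtomisticToContinuum.HydrodynamicLimit.Theorems.JaynesSqueezeLocalGibbsConcentrationDiluteRatioUniform2
import Summits.AtomisticToContinuum.HydrodynamicLimit.Theorems.ImplosionDichotomyPolynomialCompressionEosCesaro

/-!
# The excess free energy of the dilute hard-sphere gas as an integral of the log insertion ratio

Helper file for item `LocalGibbsConcentrationDilute` (stmt-AtomisticToContinuum-13460) of route
`JaynesSqueeze`; second part of the unconditional identification of the local-density
approximation. For the homogeneous canonical hard-sphere gas on `𝕋³` at small reduced density
`σ`:

* `log_XiN_eq_neg_sum`: `log Ξ_N(N+1) = -∑_{m ≤ N} log q_N(m)` (telescoping);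
* `riemann_right`: Riemann sums at right endpoints of a Lipschitz function on `(0, 1]`
  (`|log a - log b| ≤ 2|a - b|` on `[1/2, ∞)` is `EosCesaro.abs_log_sub_log_le_two_mul`);
* `tendsto_neg_log_XiN_div`: `-(N+1)⁻¹ log Ξ_N(N+1) → ∫₀¹ log R(σ s^{1/3}) ds` (uniform
  convergence of the ratios `qN_uniform`, Lipschitz continuity of `s ↦ R(σ s^{1/3})`);
* `hsExcessFreeEnergy_eq_integral`: `f_ex(σ³) = ∫₀¹ log R(σ s^{1/3}) ds` (the free volume is
  `Ξ_N(N+1)` for the uniform law, `hsFreeVolume_eq_XiT`).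

No definitions (pure-proof helper file). prover-pitem-stmt-AtomisticToContinuum-13460-0.
-/

noncomputable section

namespace Summit.AtomisticToContinuum.HydrodynamicLimit.Theorems

open MeasureTheory Filter Topology Set Finset intervalIntegral
open Literature.Analysis.FluidPDE Literature.MathematicalPhysics.KineticTheory
open Literature.MathematicalPhysics.StatisticalMechanics Literature.Probability.LatticeModels
open scoped ENNReal

namespace LocalGibbsConcentration

section Telescoping

/-- The one-particle law of the uniform profile is the Haar measure. [folklore] -/
theorem μ_uniformProfile : uniformProfile.μ = (volume : Measure T3) := by
  rw [DensityProfile.μ]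
  simp [uniformProfile, ENNReal.ofReal_one]

/-- **The free-volume partition function is `Ξ_N(N+1)` of the uniform profile.** [folklore] -/
theorem XiT_eq_XiN (σ : ℝ) (N : ℕ) :
    XiT (hsDiameter σ N) (N + 1) = XiN uniformProfile σ N (N + 1) := by
  rw [XiT_eq_hcProb, XiN, Xi, firstLabels_self, μ_uniformProfile]

/-- **Telescoping**: `log Ξ_N(N+1) = -∑_{m ≤ N} log q_N(m)` (`Ξ_N(0) = 1`, all partition functions
positive at small density). [folklore] -/
theorem log_XiN_eq_neg_sum {σ : ℝ} (hσ : 0 ≤ σ) (hσ2 : σ < 1 / 2) (hlam : ovDensity uniformProfile σ < 1)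
    (N : ℕ) :
    Real.log (XiN uniformProfile σ N (N + 1)) =
      -∑ m ∈ Finset.range (N + 1), Real.log (qN uniformProfile σ N m) := by
  have hpos : ∀ k ≤ N + 1, 0 < XiN uniformProfile σ N k := fun k hk => XiN_pos hσ hσ2 hlam hk
  have key : ∀ n ≤ N + 1, Real.log (XiN uniformProfile σ N n) =
      -∑ m ∈ Finset.range n, Real.log (qN uniformProfile σ N m) := by
    intro n
    induction n with
    | zero => intro _; simp [XiN, Xi_zero]
    | succ n ih =>
        intro hn
        rw [Finset.sum_range_succ, neg_add, ← ih (by omega), qN,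
          Real.log_div (hpos n (by omega)).ne' (hpos (n + 1) hn).ne']
        ring
  exact key (N + 1) le_rfl

end Telescoping

section Riemann

/-- **Riemann sums at right endpoints of a Lipschitz function on `(0, 1]`**: if
`|g s - g s'| ≤ K |s - s'|` on `(0, 1]` then
`|(N+1)⁻¹ ∑_{m ≤ N} g((m+1)/(N+1)) - ∫₀¹ g| ≤ K/(N+1)`. [folklore] -/
theorem riemann_right {g : ℝ → ℝ} {K : ℝ} (hK : 0 ≤ K)
    (hlip : ∀ s ∈ Ioc (0 : ℝ) 1, ∀ s' ∈ Ioc (0 : ℝ) 1, |g s - g s'| ≤ K * |s - s'|)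
    (hint : ∀ a b : ℝ, 0 ≤ a → a ≤ b → b ≤ 1 → IntervalIntegrable g volume a b) (N : ℕ) :
    |((N + 1 : ℕ) : ℝ)⁻¹ * ∑ m ∈ Finset.range (N + 1), g (((m + 1 : ℕ) : ℝ) / ((N + 1 : ℕ) : ℝ)) -
      ∫ s in (0 : ℝ)..1, g s| ≤ K / ((N + 1 : ℕ) : ℝ) := by
  set n : ℝ := ((N + 1 : ℕ) : ℝ) with hn
  have hnpos : 0 < n := by rw [hn]; positivity
  set a : ℕ → ℝ := fun k => (k : ℝ) / n with ha
  have ha0 : a 0 = 0 := by simp [ha]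
  have haN : a (N + 1) = 1 := by rw [ha]; simp only; rw [hn, div_self hnpos.ne']
  have hamono : ∀ k, a k ≤ a (k + 1) := fun k => by
    rw [ha]; simp only; gcongr; exact_mod_cast Nat.le_succ k
  have hastep : ∀ k, a (k + 1) - a k = n⁻¹ := fun k => by
    rw [ha]; simp only; push_cast; field_simp; ring
  have hamem : ∀ k ≤ N + 1, 0 ≤ a k ∧ a k ≤ 1 := fun k hk => by
    rw [ha]; simp only
    refine ⟨by positivity, ?_⟩
    rw [div_le_one hnpos, hn]; exact_mod_cast hk
  -- the integral as a sum over cells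
  have hsum : ∫ s in (0 : ℝ)..1, g s = ∑ m ∈ Finset.range (N + 1), ∫ s in a m..a (m + 1), g s := by
    rw [← ha0, ← haN]
    exact (sum_integral_adjacent_intervals fun k hk =>
      hint _ _ (hamem k hk.le).1 (hamono k) (hamem (k + 1) hk).2).symm
  -- each cell
  have hcell : ∀ m ∈ Finset.range (N + 1),
      |n⁻¹ * g (a (m + 1)) - ∫ s in a m..a (m + 1), g s| ≤ K * n⁻¹ * n⁻¹ := by
    intro m hm
    have hm' : m < N + 1 := Finset.mem_range.1 hm
    have hconst : ∫ _ in a m..a (m + 1), g (a (m + 1)) = n⁻¹ * g (a (m + 1)) := by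
      rw [intervalIntegral.integral_const, hastep, smul_eq_mul]
    rw [← hconst, ← intervalIntegral.integral_sub intervalIntegrable_const
      (hint _ _ (hamem m hm'.le).1 (hamono m) (hamem (m + 1) hm').2)]
    have hbound : ∀ s ∈ Set.uIoc (a m) (a (m + 1)), ‖g s - g (a (m + 1))‖ ≤ K * n⁻¹ := by
      intro s hs
      rw [uIoc_of_le (hamono m)] at hs
      have hs1 : s ∈ Ioc (0 : ℝ) 1 := ⟨(hamem m hm'.le).1.trans_lt hs.1, hs.2.trans (hamem _ hm').2⟩
      have ha1 : a (m + 1) ∈ Ioc (0 : ℝ) 1 :=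
        ⟨(hamem m hm'.le).1.trans_lt (hs.1.trans_le hs.2), (hamem _ hm').2⟩
      rw [Real.norm_eq_abs]
      refine (hlip s hs1 _ ha1).trans (mul_le_mul_of_nonneg_left ?_ hK)
      rw [abs_of_nonpos (by linarith [hs.2])]
      have := hastep m
      linarith [hs.1]
    have h := intervalIntegral.norm_integral_le_of_norm_le_const hbound
    rw [Real.norm_eq_abs, abs_of_nonneg (by linarith [hamono m] : 0 ≤ a (m + 1) - a m), hastep] at h
    have hflip : (∫ s in a m..a (m + 1), g (a (m + 1)) - g s) = -∫ s in a m..a (m + 1), g s - g (a (m + 1)) := by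
      rw [← intervalIntegral.integral_neg]
      congr 1; funext s; ring
    rw [hflip, abs_neg]
    exact h
  -- assemble
  rw [hsum, Finset.mul_sum, ← Finset.sum_sub_distrib]
  refine (Finset.abs_sum_le_sum_abs _ _).trans ?_
  calc ∑ m ∈ Finset.range (N + 1), |n⁻¹ * g (((m + 1 : ℕ) : ℝ) / n) - ∫ s in a m..a (m + 1), g s|
      ≤ ∑ _m ∈ Finset.range (N + 1), K * n⁻¹ * n⁻¹ :=
        Finset.sum_le_sum fun m hm => by
          have := hcell m hm
          rwa [ha] at this
    _ = K / n := by
        rw [Finset.sum_const, Finset.card_range, nsmul_eq_mul, ← hn]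
        field_simp

end Riemann

section Limit

variable {σ : ℝ} (h : SmallDensity uniformProfile σ)
include h

/-- **`s ↦ log R(σ s^{1/3})` is Lipschitz on `(0, 1]`** with constant `2 L σ³`
(`abs_ratioLimit_sub_le`, `|log a - log b| ≤ 2|a - b|` on `[1/2, ∞)`). [folklore] -/
theorem abs_log_ratioLimit_sub_le {s s' : ℝ} (hs : s ∈ Ioc (0 : ℝ) 1) (hs' : s' ∈ Ioc (0 : ℝ) 1) :
    |Real.log (ratioLimit uniformProfile (σ * s ^ (1 / 3 : ℝ))) -
      Real.log (ratioLimit uniformProfile (σ * s' ^ (1 / 3 : ℝ)))| ≤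
      2 * (8 * (2 * Real.exp 1 ^ 2 * v₁ / (1 - geomRatio uniformProfile σ) ^ 2)) * σ ^ 3 * |s - s'| := by
  have hσ := h.σ_pos
  -- the two sub-densities
  have hmem : ∀ u ∈ Ioc (0 : ℝ) 1, 0 < σ * u ^ (1 / 3 : ℝ) ∧ σ * u ^ (1 / 3 : ℝ) ≤ σ := fun u hu =>
    ⟨mul_pos hσ (Real.rpow_pos_of_pos hu.1 _),
      mul_le_of_le_one_right hσ.le (Real.rpow_le_one hu.1.le hu.2 (by norm_num))⟩
  have h1 := smallDensity_uniform_mono h (hmem s hs).1 (hmem s hs).2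
  have h2 := smallDensity_uniform_mono h (hmem s' hs').1 (hmem s' hs').2
  have hR1 := (ratioLimit_spec (P := uniformProfile) h1.σ_pos h1.σ_lt_half h1.geomRatio_lt_one h1.phi_lt_half).1
  have hR2 := (ratioLimit_spec (P := uniformProfile) h2.σ_pos h2.σ_lt_half h2.geomRatio_lt_one h2.phi_lt_half).1
  have hlip := abs_ratioLimit_sub_le h h1 h2 (hmem s hs).2 (hmem s' hs').2
  have hcube : |(σ * s ^ (1 / 3 : ℝ)) ^ 3 - (σ * s' ^ (1 / 3 : ℝ)) ^ 3| = σ ^ 3 * |s - s'| := by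
    rw [mul_pow, mul_pow, rpow_third_pow_three hs.1.le, rpow_third_pow_three hs'.1.le, ← mul_sub,
      abs_mul, abs_of_pos (pow_pos hσ 3)]
  refine (EosCesaro.abs_log_sub_log_le_two_mul hR1.1 hR2.1).trans ?_
  rw [hcube] at hlip
  nlinarith [hlip, abs_nonneg (s - s')]

/-- `|log R(σ s^{1/3})| ≤ log 2` on `(0, 1]`. [folklore] -/
theorem abs_log_ratioLimit_le {s : ℝ} (hs : s ∈ Ioc (0 : ℝ) 1) :
    |Real.log (ratioLimit uniformProfile (σ * s ^ (1 / 3 : ℝ)))| ≤ Real.log 2 := by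
  have hσ := h.σ_pos
  have hle : σ * s ^ (1 / 3 : ℝ) ≤ σ :=
    mul_le_of_le_one_right hσ.le (Real.rpow_le_one hs.1.le hs.2 (by norm_num : (0 : ℝ) ≤ 1 / 3))
  have h1 := smallDensity_uniform_mono h (mul_pos hσ (Real.rpow_pos_of_pos hs.1 _)) hle
  have hR := (ratioLimit_spec (P := uniformProfile) h1.σ_pos h1.σ_lt_half h1.geomRatio_lt_one h1.phi_lt_half).1
  rw [abs_le]
  constructor
  · rw [← Real.log_inv]
    have : (2 : ℝ)⁻¹ ≤ ratioLimit uniformProfile (σ * s ^ (1 / 3 : ℝ)) := by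
      rw [inv_eq_one_div]; exact hR.1
    exact Real.log_le_log (by norm_num) this
  · exact Real.log_le_log (by linarith [hR.1]) hR.2

/-- `s ↦ log R(σ s^{1/3})` is continuous on `(0, 1]`. [folklore] -/
theorem continuousOn_log_ratioLimit :
    ContinuousOn (fun s : ℝ => Real.log (ratioLimit uniformProfile (σ * s ^ (1 / 3 : ℝ)))) (Ioc 0 1) := by
  set K : ℝ := 2 * (8 * (2 * Real.exp 1 ^ 2 * v₁ / (1 - geomRatio uniformProfile σ) ^ 2)) * σ ^ 3 with hK
  have hK0 : 0 ≤ K := by have := v₁_pos; have := h.σ_pos; positivity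
  rw [Metric.continuousOn_iff]
  intro b hb ε hε
  refine ⟨ε / (K + 1), by positivity, fun a ha hab => ?_⟩
  rw [Real.dist_eq] at hab ⊢
  calc _ ≤ K * |a - b| := abs_log_ratioLimit_sub_le h ha hb
    _ ≤ (K + 1) * |a - b| := by gcongr; linarith
    _ < (K + 1) * (ε / (K + 1)) := mul_lt_mul_of_pos_left hab (by positivity)
    _ = ε := by field_simp

/-- `s ↦ log R(σ s^{1/3})` is interval integrable on subintervals of `[0, 1]`. [folklore] -/
theorem intervalIntegrable_log_ratioLimit {a b : ℝ} (ha : 0 ≤ a) (hab : a ≤ b) (hb : b ≤ 1) :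
    IntervalIntegrable (fun s : ℝ => Real.log (ratioLimit uniformProfile (σ * s ^ (1 / 3 : ℝ))))
      volume a b := by
  rw [intervalIntegrable_iff_integrableOn_Ioc_of_le hab]
  have hsub : Ioc a b ⊆ Ioc (0 : ℝ) 1 := fun s hs => ⟨ha.trans_lt hs.1, hs.2.trans hb⟩
  haveI : IsFiniteMeasure ((volume : Measure ℝ).restrict (Ioc a b)) :=
    ⟨by rw [Measure.restrict_apply_univ]; exact measure_Ioc_lt_top⟩
  refine (integrable_const (Real.log 2)).mono'
    (((continuousOn_log_ratioLimit h).mono hsub).aestronglyMeasurable measurableSet_Ioc) ?_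
  exact (ae_restrict_iff' measurableSet_Ioc).2 (Eventually.of_forall fun s hs => by
    rw [Real.norm_eq_abs]; exact abs_log_ratioLimit_le h (hsub hs))

/-- **The thermodynamic limit of the free energy via the insertion ratios**:
`-(N+1)⁻¹ log Ξ_N(N+1) → ∫₀¹ log R(σ s^{1/3}) ds`. [folklore] -/
theorem tendsto_neg_log_XiN_div :
    Tendsto (fun N : ℕ => -((N + 1 : ℕ) : ℝ)⁻¹ * Real.log (XiN uniformProfile σ N (N + 1))) atTop
      (𝓝 (∫ s in (0 : ℝ)..1, Real.log (ratioLimit uniformProfile (σ * s ^ (1 / 3 : ℝ))))) := by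
  have hσ := h.σ_pos
  set g : ℝ → ℝ := fun s => Real.log (ratioLimit uniformProfile (σ * s ^ (1 / 3 : ℝ))) with hg
  set K : ℝ := 2 * (8 * (2 * Real.exp 1 ^ 2 * v₁ / (1 - geomRatio uniformProfile σ) ^ 2)) * σ ^ 3 with hK
  have hK0 : 0 ≤ K := by have := v₁_pos; positivity
  set I : ℝ := ∫ s in (0 : ℝ)..1, g s with hI
  rw [Metric.tendsto_atTop]
  intro ε hε
  -- the Riemann error
  have hriem : ∀ N : ℕ, |((N + 1 : ℕ) : ℝ)⁻¹ * ∑ m ∈ Finset.range (N + 1),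
      g (((m + 1 : ℕ) : ℝ) / ((N + 1 : ℕ) : ℝ)) - I| ≤ K / ((N + 1 : ℕ) : ℝ) := fun N =>
    riemann_right hK0 (fun s hs s' hs' => abs_log_ratioLimit_sub_le h hs hs')
      (fun a b ha hab hb => intervalIntegrable_log_ratioLimit h ha hab hb) N
  -- the uniform convergence of the ratios
  have hq := qN_uniform h (ε := ε / 4) (by positivity)
  -- `K/(N+1) < ε/2` eventually
  have hKN : ∀ᶠ N : ℕ in atTop, K / ((N + 1 : ℕ) : ℝ) < ε / 2 := by
    have h0 := (tendsto_one_div_add_atTop_nhds_zero_nat (𝕜 := ℝ)).const_mul K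
    rw [mul_zero] at h0
    refine ((Metric.tendsto_nhds.1 h0) (ε / 2) (by positivity)).mono fun N hN => ?_
    rw [Real.dist_eq, sub_zero] at hN
    have := (le_abs_self _).trans_lt hN
    calc K / ((N + 1 : ℕ) : ℝ) = K * (1 / ((N : ℝ) + 1)) := by push_cast; ring
      _ < ε / 2 := this
  obtain ⟨N₀, hN₀⟩ := eventually_atTop.1 (hq.and hKN)
  refine ⟨N₀, fun N hN => ?_⟩
  obtain ⟨hqN, hKN'⟩ := hN₀ N hN
  rw [Real.dist_eq, log_XiN_eq_neg_sum hσ.le h.σ_lt_half h.ovDensity_lt_one N]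
  simp only [mul_neg, neg_mul, neg_neg]
  set n : ℝ := ((N + 1 : ℕ) : ℝ) with hn
  have hnpos : 0 < n := by rw [hn]; positivity
  -- compare the two averages termwise
  have hterm : ∀ m ∈ Finset.range (N + 1), |Real.log (qN uniformProfile σ N m) -
      g (((m + 1 : ℕ) : ℝ) / n)| ≤ 2 * (ε / 4) := by
    intro m hm
    have hmN : m ≤ N := Nat.lt_succ_iff.1 (Finset.mem_range.1 hm)
    have hq1 := one_le_qN (P := uniformProfile) hσ.le h.σ_lt_half h.ovDensity_lt_one hmN
    have h1 := smallDensity_uniform_mono h (subSigma_pos hσ N m) (subSigma_le hσ.le hmN)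
    have hR := (ratioLimit_spec (P := uniformProfile) h1.σ_pos h1.σ_lt_half h1.geomRatio_lt_one h1.phi_lt_half).1
    refine (EosCesaro.abs_log_sub_log_le_two_mul (by linarith) hR.1).trans ?_
    exact mul_le_mul_of_nonneg_left (hqN m hmN) (by norm_num)
  have havg : |n⁻¹ * ∑ m ∈ Finset.range (N + 1), Real.log (qN uniformProfile σ N m) -
      n⁻¹ * ∑ m ∈ Finset.range (N + 1), g (((m + 1 : ℕ) : ℝ) / n)| ≤ ε / 2 := by
    rw [← mul_sub, ← Finset.sum_sub_distrib, abs_mul, abs_of_pos (inv_pos.2 hnpos)]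
    calc n⁻¹ * |∑ m ∈ Finset.range (N + 1), (Real.log (qN uniformProfile σ N m) - g (((m + 1 : ℕ) : ℝ) / n))|
        ≤ n⁻¹ * ∑ m ∈ Finset.range (N + 1), |Real.log (qN uniformProfile σ N m) - g (((m + 1 : ℕ) : ℝ) / n)| :=
          mul_le_mul_of_nonneg_left (Finset.abs_sum_le_sum_abs _ _) (inv_nonneg.2 hnpos.le)
      _ ≤ n⁻¹ * ∑ _m ∈ Finset.range (N + 1), 2 * (ε / 4) :=
          mul_le_mul_of_nonneg_left (Finset.sum_le_sum hterm) (inv_nonneg.2 hnpos.le)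
      _ = ε / 2 := by
          rw [Finset.sum_const, Finset.card_range, nsmul_eq_mul, ← hn]
          field_simp
          ring
  calc |n⁻¹ * ∑ m ∈ Finset.range (N + 1), Real.log (qN uniformProfile σ N m) - I|
      ≤ |n⁻¹ * ∑ m ∈ Finset.range (N + 1), Real.log (qN uniformProfile σ N m) -
          n⁻¹ * ∑ m ∈ Finset.range (N + 1), g (((m + 1 : ℕ) : ℝ) / n)| +
        |n⁻¹ * ∑ m ∈ Finset.range (N + 1), g (((m + 1 : ℕ) : ℝ) / n) - I| := abs_sub_le _ _ _
    _ < ε / 2 + ε / 2 := add_lt_add_of_le_of_lt havg (lt_of_le_of_lt (hriem N) hKN')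
    _ = ε := by ring

/-- **The excess free energy as an integral of the log insertion ratio**:
`f_ex(σ³) = ∫₀¹ log R(σ s^{1/3}) ds` at small reduced density. [folklore] -/
theorem hsExcessFreeEnergy_eq_integral :
    hsExcessFreeEnergy (σ ^ 3) =
      ∫ s in (0 : ℝ)..1, Real.log (ratioLimit uniformProfile (σ * s ^ (1 / 3 : ℝ))) := by
  have hσ := h.σ_pos
  rw [hsExcessFreeEnergy_eq_limsup (pow_pos hσ 3)]
  set a : ℕ → ℝ := fun N => -((N + 1 : ℕ) : ℝ)⁻¹ * Real.log (XiN uniformProfile σ N (N + 1)) with ha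
  have hfN : (fun m : ℕ => fN (m + 2) (σ ^ 3)) = fun m => a (m + 1) := by
    funext m
    rw [fN, diam_eq_hsDiameter (pow_pos hσ 3).le, pow_three_rpow_third hσ.le, XiT_eq_XiN, ha]
  rw [hfN, Filter.limsup_nat_add a 1]
  exact (tendsto_neg_log_XiN_div h).limsup_eq

end Limit

end LocalGibbsConcentration

end Summit.AtomisticToContinuum.HydrodynamicLimit.Theorems
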